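import Summits.HodgeConjecture.CorCM.Census.MultiFieldWeilSetTransitive
import Summits.HodgeConjecture.CorCM.Census.MultiFieldWeilPrimeRotations
import HarnessLib

/-!
# MULTI-FIELD WEIL, census part 6: PEELING ONE SLOT BY A PURE ELEMENT — a realised tuple acting on ONE slot only makes that slot's defect constant as soon as
# its translates of the position set separate; for a conjugate ROTATION of a slot of PRIME size this is census part 5

COR-CM (cell `pub-hodgecm2`), seat b30 gen 29 (2026-08-24); count-neutral own lane MULTI-FIELD WEIL ENGINE (stem `MultiFieldWeil*`), sequel of census parts 4
(`Census/MultiFieldWeilSetTransitive`: `preG`, `exists_defects_of_const`, `const_of_signed_jointSetTransitive_on`) and 5 (`Census/MultiFieldWeilPrimeRotations`: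
`const_of_translate_sums`).  Theorems of the finite model only; no definition, no named fact, no `sorry`, no `decide`.

THE MECHANISM (the uniform shape behind the decic slot of gens 27–29: `(π₂, σ)¹² = (1, σ²)`).  Let `ρ ∈ R` be PURE at the slot `m₀` (`ρ m = 1` for `m ≠ m₀`) and `R` closed
under products.  The signed equations at `π₀ ρʲ ∈ R` and at `π₀` differ only in the slot `m₀`, whence `Σ_{a ∈ (π₀ρʲ)_{m₀}⁻¹ P} d_{m₀} = Σ_{a ∈ (π₀)_{m₀}⁻¹ P} d_{m₀}` for all
`j`: if these translates separate, `d_{m₀}` is constant (**`const_of_signed_pure`**) — with NO condition on the other slots, so the slot is PEELED and the remaining slots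
may be treated by joint set-transitivity among themselves (`const_of_signed_jointSetTransitive_on`) or by further pure elements, and the law assembled by
`exists_defects_of_const`.  For `ρ_{m₀} = g (+1) g⁻¹` a conjugate ROTATION of a slot of PRIME size `ℓ` and `0 < |P| < ℓ` the translates are the `ℓ` rotations of a
`|P|`-set read through `g` (**`preG_conj_rotate_pow_eq_image`**, **`sum_preG_conj_rotate_pow`**) and census part 5 separates them: **`sep_of_conj_rotate`** (in an instance the slot type `Fin (n m₀)` is
literally `Fin (k+1)` and the two combine directly).  For peeling SEVERAL prime slots from the largest down, **`const_of_signed_pure_on`** asks purity only on the live slots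
(the slots already peeled may be moved by `ρ`: their signed sums are tuple-independent).
[cite: DixonMortimer1996, §2.1] [cite: MoonenZarhin1995Duke, Thm. 2.4] [cite: GaoUllmo2025, Thm 3.1]

## References
* [DixonMortimer1996] J. D. Dixon, B. Mortimer, *Permutation Groups*, GTM 163, §2.1.  [MoonenZarhin1995Duke] B. Moonen, Yu. Zarhin, Duke Math. J. 77 (1995), Thm. 2.4.
  [GaoUllmo2025] Z. Gao, E. Ullmo, J. Inst. Math. Jussieu 25 (2025), Thm 3.1.
-/

namespace Summit.HodgeConjecture.CorCM.Census.MultiFieldWeil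

open Finset
open Fin.NatCast

variable {r : ℕ} {n : Fin r → ℕ} {R : Finset (PermsG n)} {P : ∀ m : Fin r, Finset (Fin (n m))}

/-! ### Peeling a slot by a pure element -/

/-- `π ρʲ ∈ R` for `π, ρ ∈ R`, `R` closed under products. [folklore] -/
theorem mul_pow_mem (hmul : ∀ π ∈ R, ∀ π' ∈ R, π * π' ∈ R) {π ρ : PermsG n} (hπ : π ∈ R) (hρ : ρ ∈ R) (j : ℕ) : π * ρ ^ j ∈ R := by
  induction j with
  | zero => rw [pow_zero, mul_one]; exact hπ
  | succ j ih => rw [pow_succ, ← mul_assoc]; exact hmul _ ih _ hρ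

/-- `|σ⁻¹ P| = |P|`. [folklore] -/
theorem card_preG {k : ℕ} (σ : Equiv.Perm (Fin k)) (P : Finset (Fin k)) : (preG σ P).card = P.card := card_filter_perm_mem σ P

/-- **PEELING ONE SLOT BY A PURE ELEMENT.**  `R` closed under products, `ρ ∈ R` pure at `m₀`, `π₀ ∈ R`: if the sums of a function through the translates
`((π₀)_{m₀} ρ_{m₀}ʲ)⁻¹(P m₀)`, `j ≥ 0`, being all equal forces the function to be constant (`hsep`), then the defect `d_{m₀}` of any solution of the signed equations is
constant — whatever happens in the other slots. [cite: DixonMortimer1996, §2.1] [cite: MoonenZarhin1995Duke, Thm. 2.4] -/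
theorem const_of_signed_pure (hmul : ∀ π ∈ R, ∀ π' ∈ R, π * π' ∈ R) {m₀ : Fin r} {ρ : PermsG n} (hρ : ρ ∈ R) (hpure : ∀ m, m ≠ m₀ → ρ m = 1)
    {π₀ : PermsG n} (hπ₀ : π₀ ∈ R)
    (hsep : ∀ f : Fin (n m₀) → ℤ, (∀ j : ℕ, ∑ a ∈ preG (π₀ m₀ * ρ m₀ ^ j) (P m₀), f a = ∑ a ∈ preG (π₀ m₀) (P m₀), f a) → ∀ a b : Fin (n m₀), f a = f b)
    {e : ℤ} {d : ∀ m : Fin r, Fin (n m) → ℤ}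
    (h : ∀ π ∈ R, e + ∑ m : Fin r, ∑ a : Fin (n m), (if π m a ∈ P m then d m a else -d m a) = 0) :
    ∀ a b : Fin (n m₀), d m₀ a = d m₀ b := by
  classical
  refine hsep (d m₀) fun j => ?_
  have hj := h _ (mul_pow_mem hmul hπ₀ hρ j)
  have h0 := h _ hπ₀
  have hsplit : ∀ π : PermsG n, (∑ m : Fin r, ∑ a : Fin (n m), (if π m a ∈ P m then d m a else -d m a)) =
      (∑ a : Fin (n m₀), (if π m₀ a ∈ P m₀ then d m₀ a else -d m₀ a)) +
        ∑ m ∈ univ.erase m₀, ∑ a : Fin (n m), (if π m a ∈ P m then d m a else -d m a) := fun π =>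
    (Finset.add_sum_erase univ (fun m => ∑ a : Fin (n m), (if π m a ∈ P m then d m a else -d m a)) (Finset.mem_univ m₀)).symm
  have hrest : (∑ m ∈ univ.erase m₀, ∑ a : Fin (n m), (if (π₀ * ρ ^ j) m a ∈ P m then d m a else -d m a)) =
      ∑ m ∈ univ.erase m₀, ∑ a : Fin (n m), (if π₀ m a ∈ P m then d m a else -d m a) :=
    Finset.sum_congr rfl fun m hm => by rw [Pi.mul_apply, Pi.pow_apply, hpure m (Finset.ne_of_mem_erase hm), one_pow, mul_one]
  have hm₀ : (π₀ * ρ ^ j) m₀ = π₀ m₀ * ρ m₀ ^ j := by rw [Pi.mul_apply, Pi.pow_apply]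
  rw [hsplit, hrest, hm₀, sum_ite_mem_eq_of_iff (Q := preG (π₀ m₀ * ρ m₀ ^ j) (P m₀)) (fun a => mem_preG.symm) (d m₀)] at hj
  rw [hsplit, sum_ite_mem_eq_of_iff (Q := preG (π₀ m₀) (P m₀)) (fun a => mem_preG.symm) (d m₀)] at h0
  linarith

/-- **PEELING ONE SLOT BY AN ELEMENT PURE ON THE LIVE SLOTS ONLY** (the form used when peeling several prime slots from the largest down): `ρ ∈ R` need only be the identity on a
set `M` of slots; every slot outside `M ∪ {m₀}` must already have a constant defect (`hout` — its signed sum then does not depend on the tuple).  Same conclusion as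
`const_of_signed_pure`. [cite: DixonMortimer1996, §2.1] [cite: MoonenZarhin1995Duke, Thm. 2.4] -/
theorem const_of_signed_pure_on (hmul : ∀ π ∈ R, ∀ π' ∈ R, π * π' ∈ R) {m₀ : Fin r} (M : Finset (Fin r)) {ρ : PermsG n} (hρ : ρ ∈ R) (hpure : ∀ m ∈ M, ρ m = 1)
    {π₀ : PermsG n} (hπ₀ : π₀ ∈ R)
    (hsep : ∀ f : Fin (n m₀) → ℤ, (∀ j : ℕ, ∑ a ∈ preG (π₀ m₀ * ρ m₀ ^ j) (P m₀), f a = ∑ a ∈ preG (π₀ m₀) (P m₀), f a) → ∀ a b : Fin (n m₀), f a = f b)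
    {e : ℤ} {d : ∀ m : Fin r, Fin (n m) → ℤ} (hout : ∀ m, m ∉ M → m ≠ m₀ → ∀ a b : Fin (n m), d m a = d m b)
    (h : ∀ π ∈ R, e + ∑ m : Fin r, ∑ a : Fin (n m), (if π m a ∈ P m then d m a else -d m a) = 0) :
    ∀ a b : Fin (n m₀), d m₀ a = d m₀ b := by
  classical
  refine hsep (d m₀) fun j => ?_
  have hj := h _ (mul_pow_mem hmul hπ₀ hρ j)
  have h0 := h _ hπ₀
  have hsplit : ∀ π : PermsG n, (∑ m : Fin r, ∑ a : Fin (n m), (if π m a ∈ P m then d m a else -d m a)) =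
      (∑ a : Fin (n m₀), (if π m₀ a ∈ P m₀ then d m₀ a else -d m₀ a)) +
        ∑ m ∈ univ.erase m₀, ∑ a : Fin (n m), (if π m a ∈ P m then d m a else -d m a) := fun π =>
    (Finset.add_sum_erase univ (fun m => ∑ a : Fin (n m), (if π m a ∈ P m then d m a else -d m a)) (Finset.mem_univ m₀)).symm
  -- the other slots: unchanged on `M` (`ρ m = 1`), tuple-independent off `M` (constant defect)
  have hrest : (∑ m ∈ univ.erase m₀, ∑ a : Fin (n m), (if (π₀ * ρ ^ j) m a ∈ P m then d m a else -d m a)) =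
      ∑ m ∈ univ.erase m₀, ∑ a : Fin (n m), (if π₀ m a ∈ P m then d m a else -d m a) := by
    refine Finset.sum_congr rfl fun m hm => ?_
    by_cases hmM : m ∈ M
    · rw [Pi.mul_apply, Pi.pow_apply, hpure m hmM, one_pow, mul_one]
    · have hmc := hout m hmM (Finset.ne_of_mem_erase hm)
      by_cases hm0 : 0 < n m
      · rw [Finset.sum_congr rfl fun a _ => by rw [hmc a ⟨0, hm0⟩], sum_ite_mem_const,
          Finset.sum_congr rfl fun a _ => by rw [hmc a ⟨0, hm0⟩], sum_ite_mem_const]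
      · rw [Finset.sum_eq_zero fun a _ => absurd a.2 (by have := Nat.eq_zero_of_not_pos hm0; omega),
          Finset.sum_eq_zero fun a _ => absurd a.2 (by have := Nat.eq_zero_of_not_pos hm0; omega)]
  have hm₀ : (π₀ * ρ ^ j) m₀ = π₀ m₀ * ρ m₀ ^ j := by rw [Pi.mul_apply, Pi.pow_apply]
  rw [hsplit, hrest, hm₀, sum_ite_mem_eq_of_iff (Q := preG (π₀ m₀ * ρ m₀ ^ j) (P m₀)) (fun a => mem_preG.symm) (d m₀)] at hj
  rw [hsplit, sum_ite_mem_eq_of_iff (Q := preG (π₀ m₀) (P m₀)) (fun a => mem_preG.symm) (d m₀)] at h0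
  linarith

/-! ### A conjugate rotation of a slot of prime size: the translates are rotations, census part 5 separates them -/

/-- The powers of the rotation `finRotate (k+1) = (+1)`: `(+1)ʲ c = c + j`. [folklore] -/
theorem finRotate_pow_apply_natCast {k : ℕ} (j : ℕ) (c : Fin (k + 1)) : ((finRotate (k + 1)) ^ j) c = c + (j : Fin (k + 1)) := by
  induction j with
  | zero => rw [pow_zero, Equiv.Perm.one_apply, Nat.cast_zero, add_zero]
  | succ j ih => rw [pow_succ', Equiv.Perm.mul_apply, ih, finRotate_apply, Nat.cast_succ, add_assoc]

/-- **The translates by a conjugate rotation are rotations read through `g`**: `(σ (g (+1) g⁻¹)ʲ)⁻¹ P = g((σ g)⁻¹ P − j)`. [folklore] -/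
theorem preG_conj_rotate_pow_eq_image {k : ℕ} (σ g : Equiv.Perm (Fin (k + 1))) (P : Finset (Fin (k + 1))) (j : ℕ) :
    preG (σ * (g * finRotate (k + 1) * g⁻¹) ^ j) P = (preG (σ * g) P).image fun x => g (x - (j : Fin (k + 1))) := by
  ext a
  rw [mem_preG, Finset.mem_image, conj_pow, Equiv.Perm.mul_apply, Equiv.Perm.mul_apply, Equiv.Perm.mul_apply, finRotate_pow_apply_natCast]
  constructor
  · intro ha
    refine ⟨g⁻¹ a + (j : Fin (k + 1)), ?_, ?_⟩
    · rw [mem_preG, Equiv.Perm.mul_apply]; exact ha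
    · rw [add_sub_cancel_right, Equiv.Perm.inv_def, Equiv.apply_symm_apply]
  · rintro ⟨x, hx, rfl⟩
    rw [mem_preG, Equiv.Perm.mul_apply] at hx
    rw [Equiv.Perm.inv_def, Equiv.symm_apply_apply, sub_add_cancel]
    exact hx

/-- Hence the sums through the translates are translate sums of `f ∘ g` through the fixed set `(σ g)⁻¹ P`. [folklore] -/
theorem sum_preG_conj_rotate_pow {k : ℕ} (σ g : Equiv.Perm (Fin (k + 1))) (P : Finset (Fin (k + 1))) (f : Fin (k + 1) → ℤ) (j : ℕ) :
    ∑ a ∈ preG (σ * (g * finRotate (k + 1) * g⁻¹) ^ j) P, f a = ∑ x ∈ preG (σ * g) P, f (g (x - (j : Fin (k + 1)))) := by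
  rw [preG_conj_rotate_pow_eq_image, Finset.sum_image]
  intro x _ y _ hxy
  exact sub_left_injective (g.injective hxy)

/-- **A conjugate rotation of a slot of PRIME size separates** (`0 < |P| < ℓ`): census part 5 applied to `f ∘ g` on the `|P|`-set `(σ g)⁻¹ P`.
[cite: DixonMortimer1996, §2.1] -/
theorem sep_of_conj_rotate {k : ℕ} [Fact (k + 1).Prime] (σ g : Equiv.Perm (Fin (k + 1))) {P : Finset (Fin (k + 1))} (hP0 : P.Nonempty) (hPk : P.card < k + 1)
    (f : Fin (k + 1) → ℤ) (h : ∀ j : ℕ, ∑ a ∈ preG (σ * (g * finRotate (k + 1) * g⁻¹) ^ j) P, f a = ∑ a ∈ preG σ P, f a) (a b : Fin (k + 1)) :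
    f a = f b := by
  -- the translate sums of `u = f ∘ g` through `Q = (σ g)⁻¹ P` do not depend on the translate
  set Q : Finset (Fin (k + 1)) := preG (σ * g) P with hQ
  have hQ0 : Q.Nonempty := by rw [← Finset.card_pos, hQ, card_preG]; exact Finset.card_pos.2 hP0
  have hQk : Q.card < k + 1 := by rw [hQ, card_preG]; exact hPk
  have hbase : (∑ x ∈ Q, f (g x)) = ∑ a ∈ preG σ P, f a := by
    have h0 := h 0
    rw [sum_preG_conj_rotate_pow, Nat.cast_zero] at h0
    simpa using h0
  have hu : ∀ j : Fin (k + 1), (∑ x ∈ Q, f (g (x + j))) = ∑ x ∈ Q, f (g x) := by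
    intro j
    have h1 := h ((-j : Fin (k + 1)) : ℕ)
    rw [sum_preG_conj_rotate_pow, Fin.cast_val_eq_self] at h1
    simp only [sub_neg_eq_add] at h1
    rw [h1, hbase]
  have hconst := const_of_translate_sums Q hQ0 hQk (u := fun y => f (g y)) hu
  have ha := hconst (g⁻¹ a) (g⁻¹ b)
  simp only [Equiv.Perm.inv_def, Equiv.apply_symm_apply] at ha
  exact ha

end Summit.HodgeConjecture.CorCM.Census.MultiFieldWeil
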